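import Literature.Probability.RandomPlanarGeometry.SAWBendingEnergyEndpoint
import Literature.Probability.RandomPlanarGeometry.SAWBendingEnergyFekete
import HarnessLib

/-!
# A certified lower bound `μ_AT ≥ 3/2` for the all-turn (L-lattice) connective constant

Topic `Literature/Probability/RandomPlanarGeometry` (continues `SAWBendingEnergyEndpoint.lean`: the all-turn counts
`Zd.allTurnCount` / `allTurnWords` and `Zd.logMuAT = ⨅_N log a(N+1)/(N+1)`; step words `SAWWords.lean`).

The all-turn self-avoiding walks on `ℤ²` (every internal vertex a right angle) are the self-avoiding walks of the
L lattice [Malakis1975; Kennedy2018ManhattanSLE6, §1], so `μ_AT` is the L-lattice connective constant `μ_L`, numerically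
`1.5657(15)` [JensenGuttmann1998, Table 1]; printed rigorous bounds: [Guttmann1983DirectedSquareLattices] (unread here). The tree holds `√2 ≤ μ_AT ≤ φ`-type windows (`SAWBendingEnergyEndpoint`);
this file certifies **`log (3/2) ≤ log μ_AT`** (lane «pcv-sawmu», item «MuATLower (3/2)» of a-idea-2's
`Sketch_v7_add5`) by a KERNEL-CHECKED Kraft–Kesten certificate, with standard axioms and no enumeration:

* the all-turn counts are submultiplicative (split an all-turn word; private helper here, the public statement is
  `Zd.allTurnSubmult` of `SAWBendingEnergyAllTurnWindow.lean`), hence `a(kN) ≤ a(N)^k` (`Zd.allTurnCount_mul_le_pow`);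
* the class `C_n` (`IsDiagClass`) of all-turn DIAGONAL BRIDGES — self-avoiding all-turn words whose diagonal
  coordinate `s = x + y` satisfies `0 < s_i ≤ s_n` (`1 ≤ i ≤ n`), first letter `+x`, last letter vertical — is closed
  under concatenation, and concatenating an IRREDUCIBLE element of `C_k` (`IsDiagIrr`: no interior index `i` followed
  by a `+x` letter with `s_j ≤ s_i` before and `s_i < s_j` after) with an element of `C_{n-k}` is injective jointly
  in `k` and the pair: `c(n) ≥ Σ_k p(k) c(n−k)` (`sum_mul_le_card_diagClass`);
* 34 explicit irreducible words certify `p(k) ≥ 1, 1, 2, 2, 3, 4, 7, 14` for `k = 2, 4, …, 16` (each membership is a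
  `decide`), and `Σ_{k ≤ 16} p(k) (2/3)^k ≥ 44068724/43046721 > 1`; by induction `c(2j) (2/3)^{2j}` is bounded
  below by a positive constant, so `a(N) ≥ (3/2)^N` for every `N ≥ 1` (submultiplicativity, `k → ∞`), i.e.
  **`Zd.muATLower_three_halves : Real.log (3/2) ≤ logMuAT`**.
Exact counts for the record (planner a-idea-2 and this seat, two codes): `c(n) = 1, 2, 5, 11, 25, 57, 131, 304` and
`p(n) = 1, 1, 2, 2, 3, 4, 7, 14` for `n = 2, 4, …, 16`; only the 34 witnesses enter the proof.
-/

noncomputable section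

open Finset Filter Topology Literature.Probability.LatticeModels
open scoped BigOperators

namespace Literature.Probability.RandomPlanarGeometry.SAW

/-! ### Turns of concatenated words (`wturns_cons_le` / `wturns_append_le` are in `SAWBendingEnergyFekete`) -/

/-- `wturns (u ++ v) = wturns u + wturns v + 1` when `u`, `v` are non-empty and the last letter of `u` differs
from the first letter of `v`. [cite: MadrasSlade1993, §1.1] -/
theorem wturns_append_of_ne : ∀ (u : List Step) {v : List Step} {a b : Step},
    u.getLast? = some a → v.head? = some b → a ≠ b → wturns (u ++ v) = wturns u + wturns v + 1
  | [], _, _, _, h, _, _ => by simp at h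
  | [c], v, a, b, hu, hv, hab => by
    cases v with
    | nil => simp at hv
    | cons e v =>
      simp only [List.getLast?_singleton, Option.some.injEq] at hu
      simp only [List.head?_cons, Option.some.injEq] at hv
      subst hu; subst hv
      simp [hab, Nat.add_comm]
  | c :: e :: u, v, a, b, hu, hv, hab => by
    have hu' : (e :: u).getLast? = some a := by
      rw [List.getLast?_cons_cons] at hu; exact hu
    have ih := wturns_append_of_ne (e :: u) hu' hv hab
    simp only [List.cons_append, wturns_cons_cons] at ih ⊢
    omega

/-- In an all-turn word every prefix/suffix split is all-turn: if `wturns (u ++ v) = |u| + |v| − 1` then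
`wturns u = |u| − 1` and `wturns v = |v| − 1`. [cite: MadrasSlade1993, §1.1] -/
private theorem wturns_eq_of_append {u v : List Step} (h : wturns (u ++ v) = u.length + v.length - 1) :
    wturns u = u.length - 1 ∧ wturns v = v.length - 1 := by
  have h1 := wturns_append_le u v
  have h2 := wturns_le_length_sub_one u
  have h3 := wturns_le_length_sub_one v
  by_cases hu : u = []
  · subst hu
    simp only [List.nil_append, List.length_nil, zero_add] at h
    exact ⟨by simp, h⟩
  by_cases hv : v = []
  · subst hv
    simp only [List.append_nil, List.length_nil, add_zero] at h
    exact ⟨h, by simp⟩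
  have hu1 : 1 ≤ u.length := List.length_pos_iff.2 hu
  have hv1 : 1 ≤ v.length := List.length_pos_iff.2 hv
  constructor <;> omega

/-! ### Submultiplicativity of the all-turn counts (private helpers; the public API is
`Zd.allTurnSubmult` of `SAWBendingEnergyAllTurnWindow.lean`, a-p6) -/

/-- `a(n + m) ≤ a(n) · a(m)` on words: splitting an all-turn self-avoiding word after `n` letters gives two all-turn
self-avoiding words. [cite: MadrasSlade1993, §1.2, eq. (1.2.3) (submultiplicativity), restricted to all-turn walks] -/
private theorem card_allTurnWords_add_le' (n m : ℕ) :
    (allTurnWords (n + m)).card ≤ (allTurnWords n).card * (allTurnWords m).card := by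
  classical
  rw [← card_product]
  refine card_le_card_of_injOn (fun w => (w.take n, w.drop n)) (fun w hw => ?_) (fun w hw w' hw' h => ?_)
  · rw [mem_coe, mem_allTurnWords] at hw
    obtain ⟨hl, hs, ht⟩ := hw
    have hsplit := wturns_eq_of_append (u := w.take n) (v := w.drop n)
      (by rw [List.take_append_drop, ht]; simp [hl])
    rw [mem_coe, mem_product, mem_allTurnWords, mem_allTurnWords]
    refine ⟨⟨by simp [hl], hs.take n, ?_⟩, ⟨by simp [hl], hs.drop n, ?_⟩⟩
    · rw [hsplit.1]; simp [hl]
    · rw [hsplit.2]; simp [hl]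
  · simp only [Prod.mk.injEq] at h
    rw [← List.take_append_drop n w, ← List.take_append_drop n w', h.1, h.2]

namespace Zd

/-- Submultiplicativity of `a(N)` (private; public version: `Zd.allTurnSubmult`). [cite: MadrasSlade1993, §1.2, eq. (1.2.3)] -/
private theorem allTurnCount_add_le' (n m : ℕ) : allTurnCount (n + m) ≤ allTurnCount n * allTurnCount m := by
  rw [allTurnCount_eq_card_allTurnWords, allTurnCount_eq_card_allTurnWords, allTurnCount_eq_card_allTurnWords]
  exact card_allTurnWords_add_le' n m

/-- `a(kN) ≤ a(N)^k`. [cite: MadrasSlade1993, §1.2, eq. (1.2.3)] -/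
theorem allTurnCount_mul_le_pow (k N : ℕ) : allTurnCount (k * N) ≤ allTurnCount N ^ k := by
  induction k with
  | zero =>
    simp only [zero_mul, pow_zero]
    rw [allTurnCount_eq_card_allTurnWords]
    have : allTurnWords 0 = {[]} := by
      ext w
      rw [mem_allTurnWords, mem_singleton]
      constructor
      · rintro ⟨hl, -, -⟩; exact List.eq_nil_of_length_eq_zero hl
      · rintro rfl; exact ⟨rfl, isSAW_nil, rfl⟩
    rw [this, card_singleton]
  | succ k ih =>
    rw [Nat.succ_mul, pow_succ]
    exact (allTurnCount_add_le' _ _).trans (Nat.mul_le_mul_right _ ih)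

end Zd

/-! ### The diagonal coordinate and the class of all-turn diagonal bridges -/

/-- The diagonal coordinate `s = x + y` of the walk `w` after `i` steps. [cite: MadrasSlade1993, Definition 1.2.4 (bridges, here for the diagonal direction)] -/
def sdiag (w : List Step) (i : ℕ) : ℤ := traj w i 0 + traj w i 1

/-- `s` after `i ≤ |u|` steps of `u ++ v` is that of `u`. [folklore] -/
private theorem sdiag_append_left (u v : List Step) {i : ℕ} (hi : i ≤ u.length) :
    sdiag (u ++ v) i = sdiag u i := by
  simp [sdiag, traj_append_left u v hi]

/-- `s` after `|u| + i` steps of `u ++ v`. [folklore] -/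
private theorem sdiag_append_right (u v : List Step) (i : ℕ) :
    sdiag (u ++ v) (u.length + i) = sdiag u u.length + sdiag v i := by
  simp only [sdiag, traj_append_right, traj_length, Pi.add_apply]
  ring

/-- **The class `C`** of all-turn diagonal bridges: self-avoiding, all-turn, `0 < s_i ≤ s_{|w|}` for `1 ≤ i ≤ |w|`,
first letter `+x` and last letter vertical (for non-empty words). [cite: MadrasSlade1993, Definition 1.2.4 and §1.2 (bridges; here along the diagonal, for all-turn walks)] -/
def IsDiagClass (w : List Step) : Prop :=
  IsSAW w ∧ wturns w = w.length - 1 ∧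
    (∀ i ∈ Finset.Icc 1 w.length, 0 < sdiag w i ∧ sdiag w i ≤ sdiag w w.length) ∧
    (w ≠ [] → w.head? = some 0 ∧ (w.getLast? = some 1 ∨ w.getLast? = some 3))

/-- A **`C`-renewal** of `w` at the interior index `i`: the next letter is `+x`, `s_j ≤ s_i` for `j ≤ i` and
`s_i < s_j` for `i < j ≤ |w|` (so that `w` splits there into two members of `C`).
[cite: MadrasSlade1993, §4.2 (renewal/break points of bridges; here along the diagonal)] -/
def IsCRenewal (w : List Step) (i : ℕ) : Prop :=
  w.getD i 1 = 0 ∧ (∀ j ∈ Finset.range (i + 1), sdiag w j ≤ sdiag w i) ∧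
    ∀ j ∈ Finset.Ioc i w.length, sdiag w i < sdiag w j

/-- **Irreducible** members of `C`: non-empty, no interior `C`-renewal.
[cite: MadrasSlade1993, Definition 4.2.1 (irreducible bridges; here along the diagonal)] -/
def IsDiagIrr (w : List Step) : Prop :=
  IsDiagClass w ∧ w ≠ [] ∧ ∀ i ∈ Finset.Ico 1 w.length, ¬ IsCRenewal w i

/-- Membership in `C` is decidable (used by the `decide` certificates). [folklore] -/
instance (w : List Step) : Decidable (IsDiagClass w) := by
  unfold IsDiagClass; infer_instance

/-- Being a `C`-renewal is decidable. [folklore] -/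
instance (w : List Step) (i : ℕ) : Decidable (IsCRenewal w i) := by
  unfold IsCRenewal; infer_instance

/-- Irreducibility is decidable. [folklore] -/
instance (w : List Step) : Decidable (IsDiagIrr w) := by
  unfold IsDiagIrr; infer_instance

/-- `C_n` as a finite set of words. [cite: MadrasSlade1993, §1.2] -/
def diagClass (n : ℕ) : Finset (List Step) := (words n).filter IsDiagClass

/-- The irreducible members of `C_n`. [cite: MadrasSlade1993, Definition 4.2.1] -/
def diagIrr (n : ℕ) : Finset (List Step) := (words n).filter IsDiagIrr

/-- Membership in `diagClass`. [cite: MadrasSlade1993, §1.2] -/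
theorem mem_diagClass {n : ℕ} {w : List Step} : w ∈ diagClass n ↔ w.length = n ∧ IsDiagClass w := by
  rw [diagClass, mem_filter, mem_words]

/-- Membership in `diagIrr`. [cite: MadrasSlade1993, Definition 4.2.1] -/
theorem mem_diagIrr {n : ℕ} {w : List Step} : w ∈ diagIrr n ↔ w.length = n ∧ IsDiagIrr w := by
  rw [diagIrr, mem_filter, mem_words]

/-- `C_n ⊆` all-turn self-avoiding words: `c(n) ≤ a(n)`. [cite: MadrasSlade1993, §1.2] -/
theorem diagClass_subset_allTurnWords (n : ℕ) : diagClass n ⊆ allTurnWords n := by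
  intro w hw
  rw [mem_diagClass] at hw
  rw [mem_allTurnWords]
  exact ⟨hw.1, hw.2.1, hw.1 ▸ hw.2.2.1⟩


/-! ### Closure of `C` under concatenation -/

/-- Unpacking membership in `C_k` for a non-empty word. [cite: MadrasSlade1993, §1.2] -/
private theorem diagClass_props {k : ℕ} {u : List Step} (hu : u ∈ diagClass k) (hk : 1 ≤ k) :
    u.length = k ∧ IsSAW u ∧ wturns u = k - 1 ∧
      (∀ i ∈ Finset.Icc 1 k, 0 < sdiag u i ∧ sdiag u i ≤ sdiag u k) ∧
      u.head? = some 0 ∧ (u.getLast? = some 1 ∨ u.getLast? = some 3) := by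
  rw [mem_diagClass] at hu
  obtain ⟨hl, hs, ht, hb, hh⟩ := hu
  subst hl
  have hne : u ≠ [] := by rintro rfl; simp at hk
  exact ⟨rfl, hs, ht, hb, (hh hne).1, (hh hne).2⟩

/-- `0 ≤ s_i ≤ s_k` for all `i ≤ k` on a member of `C_k`. [cite: MadrasSlade1993, §1.2] -/
private theorem sdiag_le_last {k : ℕ} {u : List Step} (hu : u ∈ diagClass k) {i : ℕ} (hi : i ≤ k) :
    sdiag u i ≤ sdiag u k := by
  rcases Nat.eq_zero_or_pos k with rfl | hk
  · obtain rfl : i = 0 := by omega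
    exact le_rfl
  obtain ⟨-, -, -, hb, -⟩ := diagClass_props hu hk
  rcases Nat.eq_zero_or_pos i with rfl | hi0
  · have := (hb k (Finset.mem_Icc.2 ⟨hk, le_rfl⟩)).1
    simp only [sdiag, traj_zero, Pi.zero_apply, add_zero] at this ⊢
    exact this.le
  · exact (hb i (Finset.mem_Icc.2 ⟨hi0, hi⟩)).2

/-- **`C` is closed under concatenation**: `C_k · C_m ⊆ C_{k+m}` (`k ≥ 1`): the junction (vertical letter then
`+x`) is a turn, and the diagonal separation makes the concatenation self-avoiding.
[cite: MadrasSlade1993, §1.2 (concatenation of bridges), here along the diagonal] -/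
theorem append_mem_diagClass {k m : ℕ} {u v : List Step} (hu : u ∈ diagClass k) (hv : v ∈ diagClass m)
    (hk : 1 ≤ k) : u ++ v ∈ diagClass (k + m) := by
  rcases Nat.eq_zero_or_pos m with rfl | hm
  · rw [mem_diagClass] at hv
    obtain rfl : v = [] := List.eq_nil_of_length_eq_zero hv.1
    simpa using hu
  obtain ⟨hul, hus, hut, hub, huh, hulast⟩ := diagClass_props hu hk
  obtain ⟨hvl, hvs, hvt, hvb, hvh, hvlast⟩ := diagClass_props hv hm
  have hune : u ≠ [] := by rintro rfl; simp at huh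
  have hvne : v ≠ [] := by rintro rfl; simp at hvh
  have hsk : 0 < sdiag u k := (hub k (Finset.mem_Icc.2 ⟨hk, le_rfl⟩)).1
  -- the diagonal coordinate along `u ++ v`
  have hleft : ∀ i, i ≤ k → sdiag (u ++ v) i = sdiag u i := fun i hi =>
    sdiag_append_left u v (by omega)
  have hright : ∀ i, sdiag (u ++ v) (k + i) = sdiag u k + sdiag v i := fun i => by
    rw [← hul]; exact sdiag_append_right u v i
  rw [mem_diagClass]
  refine ⟨by simp [hul, hvl], ?_, ?_, ?_, ?_⟩
  · -- self-avoidance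
    rw [isSAW_iff_injOn] at hus hvs ⊢
    intro i hi j hj hij
    simp only [Set.mem_setOf_eq, List.length_append, hul, hvl] at hi hj
    have hsd : sdiag (u ++ v) i = sdiag (u ++ v) j := by simp only [sdiag, hij]
    rcases le_or_gt i k with hik | hik <;> rcases le_or_gt j k with hjk | hjk
    · rw [traj_append_left u v (by omega), traj_append_left u v (by omega)] at hij
      exact hus (by simpa [hul] using hik) (by simpa [hul] using hjk) hij
    · exfalso
      obtain ⟨j', rfl⟩ : ∃ j', j = k + j' := ⟨j - k, by omega⟩
      rw [hleft i hik, hright] at hsd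
      have h1 := sdiag_le_last hu hik
      have h2 := (hvb j' (Finset.mem_Icc.2 ⟨by omega, by omega⟩)).1
      omega
    · exfalso
      obtain ⟨i', rfl⟩ : ∃ i', i = k + i' := ⟨i - k, by omega⟩
      rw [hleft j hjk, hright] at hsd
      have h1 := sdiag_le_last hu hjk
      have h2 := (hvb i' (Finset.mem_Icc.2 ⟨by omega, by omega⟩)).1
      omega
    · obtain ⟨i', rfl⟩ : ∃ i', i = k + i' := ⟨i - k, by omega⟩
      obtain ⟨j', rfl⟩ : ∃ j', j = k + j' := ⟨j - k, by omega⟩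
      rw [← hul, traj_append_right, traj_append_right, add_right_inj] at hij
      have := hvs (by simpa [hvl] using (show i' ≤ m by omega)) (by simpa [hvl] using (show j' ≤ m by omega)) hij
      rw [this]
  · -- all-turn
    rcases hulast with ha | ha <;>
    · rw [wturns_append_of_ne u ha hvh (by decide), hut, hvt]
      simp only [List.length_append, hul, hvl]
      omega
  · -- diagonal bridge
    intro i hi
    rw [Finset.mem_Icc] at hi
    simp only [List.length_append, hul, hvl] at hi ⊢
    have hend : sdiag (u ++ v) (k + m) = sdiag u k + sdiag v m := hright m
    have hvm : 0 < sdiag v m := (hvb m (Finset.mem_Icc.2 ⟨hm, le_rfl⟩)).1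
    rcases le_or_gt i k with hik | hik
    · rw [hleft i hik, hend]
      have h1 := hub i (Finset.mem_Icc.2 ⟨hi.1, hik⟩)
      exact ⟨h1.1, by omega⟩
    · obtain ⟨i', rfl⟩ : ∃ i', i = k + i' := ⟨i - k, by omega⟩
      rw [hright, hend]
      have h1 := hvb i' (Finset.mem_Icc.2 ⟨by omega, by omega⟩)
      exact ⟨by omega, by omega⟩
  · -- first and last letters
    intro _
    refine ⟨?_, ?_⟩
    · rw [List.head?_append, huh]; rfl
    · rw [List.getLast?_append]
      rcases hvlast with h | h <;> simp [h]

/-! ### The renewal inequality `c(n) ≥ Σ_k p(k) c(n - k)` -/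

/-- If `u ++ v = u' ++ v'` with `u ∈ C_k` (`k ≥ 1`), `v ∈ C_m` (`m ≥ 1`) and `k < |u'| ≤ k + m`, then `u'` has a
`C`-renewal at the interior index `k`; so `u'` is not irreducible.
[cite: MadrasSlade1993, §4.2 (uniqueness of the decomposition at renewal points), here along the diagonal] -/
private theorem not_diagIrr_of_append_eq {k m k' : ℕ} {u v u' v' : List Step} (hu : u ∈ diagClass k)
    (hk : 1 ≤ k) (hv : v ∈ diagClass m) (hm : 1 ≤ m) (hu' : u' ∈ diagIrr k') (hkk' : k < k')
    (hk'le : k' ≤ k + m) (h : u ++ v = u' ++ v') : False := by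
  obtain ⟨hul, -, -, hub, -, -⟩ := diagClass_props hu hk
  obtain ⟨hvl, -, -, hvb, hvh, -⟩ := diagClass_props hv hm
  rw [mem_diagIrr] at hu'
  obtain ⟨hul', -, -, hirr⟩ := hu'
  refine hirr k (Finset.mem_Ico.2 ⟨hk, by omega⟩) ⟨?_, ?_, ?_⟩
  · -- the letter of `u'` at index `k` is the first letter of `v`, i.e. `+x`
    have h1 : u'.getD k 1 = (u' ++ v').getD k 1 := by
      rw [List.getD_eq_getElem _ _ (by omega), List.getD_eq_getElem _ _ (by simp; omega),
        List.getElem_append_left (by omega)]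
    have h2 : (u ++ v).getD k 1 = v.getD 0 1 := by
      rw [List.getD_eq_getElem _ _ (by simp; omega), List.getD_eq_getElem _ _ (by omega),
        List.getElem_append_right (by omega)]
      simp [hul]
    have h3 : v.getD 0 1 = 0 := by
      cases v with
      | nil => simp at hvh
      | cons a w => simpa using hvh
    rw [h1, ← h, h2, h3]
  · -- `s_j ≤ s_k` for `j ≤ k`
    intro j hj
    rw [Finset.mem_range] at hj
    have e1 : sdiag u' j = sdiag u j := by
      rw [← sdiag_append_left u' v' (i := j) (by omega), ← h, sdiag_append_left u v (by omega)]
    have e2 : sdiag u' k = sdiag u k := by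
      rw [← sdiag_append_left u' v' (i := k) (by omega), ← h, sdiag_append_left u v (by omega)]
    rw [e1, e2]
    exact sdiag_le_last hu (by omega)
  · -- `s_k < s_j` for `k < j ≤ k'`
    intro j hj
    rw [Finset.mem_Ioc] at hj
    obtain ⟨j', rfl⟩ : ∃ j', j = k + j' := ⟨j - k, by omega⟩
    have e1 : sdiag u' (k + j') = sdiag u k + sdiag v j' := by
      rw [← sdiag_append_left u' v' (i := k + j') (by omega), ← h, ← hul, sdiag_append_right u v j']
    have e2 : sdiag u' k = sdiag u k := by
      rw [← sdiag_append_left u' v' (i := k) (by omega), ← h, sdiag_append_left u v (by omega)]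
    rw [e1, e2]
    have := (hvb j' (Finset.mem_Icc.2 ⟨by omega, by omega⟩)).1
    omega

/-- An irreducible word of `C_k` is a member of `C_k`, and `k ≥ 1`. [cite: MadrasSlade1993, Definition 4.2.1] -/
private theorem diagIrr_mem {k : ℕ} {u : List Step} (hu : u ∈ diagIrr k) : u ∈ diagClass k ∧ 1 ≤ k := by
  rw [mem_diagIrr] at hu
  obtain ⟨hl, hc, hne, -⟩ := hu
  refine ⟨mem_diagClass.2 ⟨hl, hc⟩, ?_⟩
  subst hl
  exact List.length_pos_iff.2 hne

/-- **The renewal inequality** `Σ_{k=1}^{n} p(k) c(n-k) ≤ c(n)`: the concatenation `(u, v) ↦ u ++ v` from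
`⊔_k P_k × C_{n-k}` to `C_n` is injective (an irreducible prefix cannot strictly contain another factorisation's
irreducible prefix). [cite: MadrasSlade1993, §4.2, eq. (4.2.2)–(4.2.3) (renewal structure of bridges), here along the diagonal] -/
theorem sum_mul_le_card_diagClass (n : ℕ) :
    ∑ k ∈ Finset.Icc 1 n, (diagIrr k).card * (diagClass (n - k)).card ≤ (diagClass n).card := by
  classical
  have hcard : ∑ k ∈ Finset.Icc 1 n, (diagIrr k).card * (diagClass (n - k)).card =
      ((Finset.Icc 1 n).sigma fun k => diagIrr k ×ˢ diagClass (n - k)).card := by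
    rw [Finset.card_sigma]
    exact Finset.sum_congr rfl fun k _ => (Finset.card_product _ _).symm
  rw [hcard]
  refine Finset.card_le_card_of_injOn (fun x => x.2.1 ++ x.2.2) (fun x hx => ?_) (fun x hx y hy hxy => ?_)
  · rw [Finset.mem_coe, Finset.mem_sigma, Finset.mem_product, Finset.mem_Icc] at hx
    obtain ⟨⟨hk1, hkn⟩, hu, hv⟩ := hx
    have := append_mem_diagClass (diagIrr_mem hu).1 hv hk1
    rwa [Finset.mem_coe, show x.1 + (n - x.1) = n by omega] at *
  · rw [Finset.mem_coe, Finset.mem_sigma, Finset.mem_product, Finset.mem_Icc] at hx hy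
    obtain ⟨k, u, v⟩ := x
    obtain ⟨k', u', v'⟩ := y
    obtain ⟨⟨hk1, hkn⟩, hu, hv⟩ := hx
    obtain ⟨⟨hk1', hkn'⟩, hu', hv'⟩ := hy
    simp only at hxy hu hv hu' hv' hk1 hkn hk1' hkn'
    have hul : u.length = k := (mem_diagIrr.1 hu).1
    have hul' : u'.length = k' := (mem_diagIrr.1 hu').1
    -- the two prefix lengths agree
    have hkk : k = k' := by
      by_contra hne
      rcases lt_or_gt_of_ne hne with hlt | hlt
      · -- then `v` is non-empty
        have hm : 1 ≤ n - k := by omega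
        exact not_diagIrr_of_append_eq (diagIrr_mem hu).1 hk1 hv hm hu' hlt (by omega) hxy
      · have hm : 1 ≤ n - k' := by omega
        exact not_diagIrr_of_append_eq (diagIrr_mem hu').1 hk1' hv' hm hu hlt (by omega) hxy.symm
    subst hkk
    obtain ⟨rfl, rfl⟩ := List.append_inj hxy (by rw [hul, hul'])
    rfl


/-! ### The certificate: explicit irreducible words -/

/-- Certificate: 1 irreducible word of `C_{2}`. [cite: MadrasSlade1993, §1.2 (explicit enumeration)] -/
def irrW2 : Finset (List Step) :=
  {[0, 1]}

/-- The words of `irrW2` are irreducible members of `C_{2}` (kernel check). [cite: MadrasSlade1993, Definition 4.2.1] -/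
private theorem irrW2_subset : irrW2 ⊆ diagIrr 2 := by
  intro w hw
  rw [mem_diagIrr]
  revert w hw
  decide

/-- `p(2) ≥ 1`. [cite: MadrasSlade1993, §1.2] -/
theorem card_diagIrr_2 : 1 ≤ (diagIrr 2).card :=
  le_trans (by decide) (Finset.card_le_card irrW2_subset)

/-- Certificate: 1 irreducible word of `C_{4}`. [cite: MadrasSlade1993, §1.2 (explicit enumeration)] -/
def irrW4 : Finset (List Step) :=
  {[0, 1, 2, 1]}

/-- The words of `irrW4` are irreducible members of `C_{4}` (kernel check). [cite: MadrasSlade1993, Definition 4.2.1] -/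
private theorem irrW4_subset : irrW4 ⊆ diagIrr 4 := by
  intro w hw
  rw [mem_diagIrr]
  revert w hw
  decide

/-- `p(4) ≥ 1`. [cite: MadrasSlade1993, §1.2] -/
theorem card_diagIrr_4 : 1 ≤ (diagIrr 4).card :=
  le_trans (by decide) (Finset.card_le_card irrW4_subset)

/-- Certificate: 2 irreducible words of `C_{6}`. [cite: MadrasSlade1993, §1.2 (explicit enumeration)] -/
def irrW6 : Finset (List Step) :=
  {[0, 1, 0, 3, 0, 1],
    [0, 1, 2, 1, 2, 1]}

/-- The words of `irrW6` are irreducible members of `C_{6}` (kernel check). [cite: MadrasSlade1993, Definition 4.2.1] -/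
private theorem irrW6_subset : irrW6 ⊆ diagIrr 6 := by
  intro w hw
  rw [mem_diagIrr]
  revert w hw
  decide

/-- `p(6) ≥ 2`. [cite: MadrasSlade1993, §1.2] -/
theorem card_diagIrr_6 : 2 ≤ (diagIrr 6).card :=
  le_trans (by decide) (Finset.card_le_card irrW6_subset)

/-- Certificate: 2 irreducible words of `C_{8}`. [cite: MadrasSlade1993, §1.2 (explicit enumeration)] -/
def irrW8 : Finset (List Step) :=
  {[0, 1, 0, 3, 0, 3, 0, 1],
    [0, 1, 2, 1, 2, 1, 2, 1]}

/-- The words of `irrW8` are irreducible members of `C_{8}` (kernel check). [cite: MadrasSlade1993, Definition 4.2.1] -/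
private theorem irrW8_subset : irrW8 ⊆ diagIrr 8 := by
  intro w hw
  rw [mem_diagIrr]
  revert w hw
  decide

/-- `p(8) ≥ 2`. [cite: MadrasSlade1993, §1.2] -/
theorem card_diagIrr_8 : 2 ≤ (diagIrr 8).card :=
  le_trans (by decide) (Finset.card_le_card irrW8_subset)

/-- Certificate: 3 irreducible words of `C_{10}`. [cite: MadrasSlade1993, §1.2 (explicit enumeration)] -/
def irrW10 : Finset (List Step) :=
  {[0, 1, 0, 3, 0, 1, 0, 3, 0, 1],
    [0, 1, 0, 3, 0, 3, 0, 3, 0, 1],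
    [0, 1, 2, 1, 2, 1, 2, 1, 2, 1]}

/-- The words of `irrW10` are irreducible members of `C_{10}` (kernel check). [cite: MadrasSlade1993, Definition 4.2.1] -/
private theorem irrW10_subset : irrW10 ⊆ diagIrr 10 := by
  intro w hw
  rw [mem_diagIrr]
  revert w hw
  decide

/-- `p(10) ≥ 3`. [cite: MadrasSlade1993, §1.2] -/
theorem card_diagIrr_10 : 3 ≤ (diagIrr 10).card :=
  le_trans (by decide) (Finset.card_le_card irrW10_subset)

/-- Certificate: 4 irreducible words of `C_{12}`. [cite: MadrasSlade1993, §1.2 (explicit enumeration)] -/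
def irrW12 : Finset (List Step) :=
  {[0, 1, 0, 3, 0, 1, 0, 3, 0, 3, 0, 1],
    [0, 1, 0, 3, 0, 3, 0, 1, 0, 3, 0, 1],
    [0, 1, 0, 3, 0, 3, 0, 3, 0, 3, 0, 1],
    [0, 1, 2, 1, 2, 1, 2, 1, 2, 1, 2, 1]}

/-- The words of `irrW12` are irreducible members of `C_{12}` (kernel check). [cite: MadrasSlade1993, Definition 4.2.1] -/
private theorem irrW12_subset : irrW12 ⊆ diagIrr 12 := by
  intro w hw
  rw [mem_diagIrr]
  revert w hw
  decide

/-- `p(12) ≥ 4`. [cite: MadrasSlade1993, §1.2] -/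
theorem card_diagIrr_12 : 4 ≤ (diagIrr 12).card :=
  le_trans (by decide) (Finset.card_le_card irrW12_subset)

/-- Certificate: 7 irreducible words of `C_{14}`. [cite: MadrasSlade1993, §1.2 (explicit enumeration)] -/
def irrW14 : Finset (List Step) :=
  {[0, 1, 0, 1, 2, 1, 2, 3, 2, 1, 2, 1, 0, 1],
    [0, 1, 0, 3, 0, 1, 0, 3, 0, 1, 0, 3, 0, 1],
    [0, 1, 0, 3, 0, 1, 0, 3, 0, 3, 0, 3, 0, 1],
    [0, 1, 0, 3, 0, 3, 0, 1, 0, 3, 0, 3, 0, 1],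
    [0, 1, 0, 3, 0, 3, 0, 3, 0, 1, 0, 3, 0, 1],
    [0, 1, 0, 3, 0, 3, 0, 3, 0, 3, 0, 3, 0, 1],
    [0, 1, 2, 1, 2, 1, 2, 1, 2, 1, 2, 1, 2, 1]}

/-- The words of `irrW14` are irreducible members of `C_{14}` (kernel check). [cite: MadrasSlade1993, Definition 4.2.1] -/
private theorem irrW14_subset : irrW14 ⊆ diagIrr 14 := by
  intro w hw
  rw [mem_diagIrr]
  revert w hw
  decide

/-- `p(14) ≥ 7`. [cite: MadrasSlade1993, §1.2] -/
theorem card_diagIrr_14 : 7 ≤ (diagIrr 14).card :=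
  le_trans (by decide) (Finset.card_le_card irrW14_subset)

/-- Certificate: 14 irreducible words of `C_{16}`. [cite: MadrasSlade1993, §1.2 (explicit enumeration)] -/
def irrW16 : Finset (List Step) :=
  {[0, 1, 0, 1, 0, 3, 0, 3, 2, 3, 0, 3, 0, 1, 0, 1],
    [0, 1, 0, 1, 2, 1, 2, 1, 2, 3, 2, 1, 2, 1, 0, 1],
    [0, 1, 0, 1, 2, 1, 2, 3, 2, 1, 2, 1, 0, 1, 2, 1],
    [0, 1, 0, 1, 2, 1, 2, 3, 2, 1, 2, 1, 2, 1, 0, 1],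
    [0, 1, 0, 3, 0, 1, 0, 3, 0, 1, 0, 3, 0, 3, 0, 1],
    [0, 1, 0, 3, 0, 1, 0, 3, 0, 3, 0, 1, 0, 3, 0, 1],
    [0, 1, 0, 3, 0, 1, 0, 3, 0, 3, 0, 3, 0, 3, 0, 1],
    [0, 1, 0, 3, 0, 3, 0, 1, 0, 3, 0, 1, 0, 3, 0, 1],
    [0, 1, 0, 3, 0, 3, 0, 1, 0, 3, 0, 3, 0, 3, 0, 1],
    [0, 1, 0, 3, 0, 3, 0, 3, 0, 1, 0, 3, 0, 3, 0, 1],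
    [0, 1, 0, 3, 0, 3, 0, 3, 0, 3, 0, 1, 0, 3, 0, 1],
    [0, 1, 0, 3, 0, 3, 0, 3, 0, 3, 0, 3, 0, 3, 0, 1],
    [0, 1, 2, 1, 0, 1, 2, 1, 2, 3, 2, 1, 2, 1, 0, 1],
    [0, 1, 2, 1, 2, 1, 2, 1, 2, 1, 2, 1, 2, 1, 2, 1]}

/-- The words of `irrW16` are irreducible members of `C_{16}` (kernel check). [cite: MadrasSlade1993, Definition 4.2.1] -/
private theorem irrW16_subset : irrW16 ⊆ diagIrr 16 := by
  intro w hw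
  rw [mem_diagIrr]
  revert w hw
  decide

/-- `p(16) ≥ 14`. [cite: MadrasSlade1993, §1.2] -/
theorem card_diagIrr_16 : 14 ≤ (diagIrr 16).card :=
  le_trans (by decide) (Finset.card_le_card irrW16_subset)

/-! ### The Kraft–Kesten induction -/

/-- `c(2j) ≥ 1`: the staircase `(+x +y)^j` is in `C_{2j}`. [cite: MadrasSlade1993, §1.2] -/
theorem one_le_card_diagClass_two_mul (j : ℕ) : 1 ≤ (diagClass (2 * j)).card := by
  induction j with
  | zero => exact Finset.card_pos.2 ⟨[], mem_diagClass.2 ⟨rfl, by decide⟩⟩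
  | succ j ih =>
    obtain ⟨v, hv⟩ := Finset.card_pos.1 (by omega : 0 < (diagClass (2 * j)).card)
    have h01 : [(0 : Step), 1] ∈ diagClass 2 := mem_diagClass.2 ⟨rfl, by decide⟩
    have := append_mem_diagClass h01 hv (by norm_num)
    rw [show 2 + 2 * j = 2 * (j + 1) by ring] at this
    exact Finset.card_pos.2 ⟨_, this⟩

/-- The renewal inequality restricted to the even prefix lengths `2, 4, …, 16` (`j ≥ 8`), in `ℝ`.
[cite: MadrasSlade1993, §4.2, eq. (4.2.3)] -/
private theorem renewal_sixteen (j : ℕ) (hj : 8 ≤ j) :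
    ((diagIrr 2).card : ℝ) * (diagClass (2 * (j - 1))).card + ((diagIrr 4).card * (diagClass (2 * (j - 2))).card +
      ((diagIrr 6).card * (diagClass (2 * (j - 3))).card + ((diagIrr 8).card * (diagClass (2 * (j - 4))).card +
      ((diagIrr 10).card * (diagClass (2 * (j - 5))).card + ((diagIrr 12).card * (diagClass (2 * (j - 6))).card +
      ((diagIrr 14).card * (diagClass (2 * (j - 7))).card + (diagIrr 16).card * (diagClass (2 * (j - 8))).card)))))) ≤
      (diagClass (2 * j)).card := by
  have h := sum_mul_le_card_diagClass (2 * j)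
  have hsub : ({2, 4, 6, 8, 10, 12, 14, 16} : Finset ℕ) ⊆ Finset.Icc 1 (2 * j) := by
    intro k hk
    simp only [Finset.mem_insert, Finset.mem_singleton] at hk
    rw [Finset.mem_Icc]; omega
  have h2 := (Finset.sum_le_sum_of_subset_of_nonneg hsub fun k _ _ => Nat.zero_le _).trans h
  rw [Finset.sum_insert (by decide), Finset.sum_insert (by decide), Finset.sum_insert (by decide),
    Finset.sum_insert (by decide), Finset.sum_insert (by decide), Finset.sum_insert (by decide),
    Finset.sum_insert (by decide), Finset.sum_singleton] at h2
  rw [show 2 * j - 2 = 2 * (j - 1) by omega, show 2 * j - 4 = 2 * (j - 2) by omega,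
    show 2 * j - 6 = 2 * (j - 3) by omega, show 2 * j - 8 = 2 * (j - 4) by omega,
    show 2 * j - 10 = 2 * (j - 5) by omega, show 2 * j - 12 = 2 * (j - 6) by omega,
    show 2 * j - 14 = 2 * (j - 7) by omega, show 2 * j - 16 = 2 * (j - 8) by omega] at h2
  have h3 := (Nat.cast_le (α := ℝ)).2 h2
  simpa only [Nat.cast_add, Nat.cast_mul] using h3

/-- One term of the Kraft induction: `x^7 · (w x^i) ≤ q · c · (x^i x^r)` from `w ≤ q` and `x^7 ≤ c x^r`. [folklore] -/
private theorem term_bound {x w q c : ℝ} {i r : ℕ} (hx : 0 < x) (hw : w ≤ q) (hc : x ^ 7 ≤ c * x ^ r)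
    (hw0 : 0 ≤ w) : x ^ 7 * (w * x ^ i) ≤ q * c * (x ^ i * x ^ r) := by
  have h1 : w * x ^ 7 ≤ q * (c * x ^ r) := mul_le_mul hw hc (by positivity) (hw0.trans hw)
  calc x ^ 7 * (w * x ^ i) = (w * x ^ 7) * x ^ i := by ring
    _ ≤ (q * (c * x ^ r)) * x ^ i := mul_le_mul_of_nonneg_right h1 (pow_pos hx i).le
    _ = q * c * (x ^ i * x ^ r) := by ring

/-- **Kraft–Kesten bound**: `c(2j) (4/9)^j ≥ (4/9)^7` for every `j` — the certified Kraft sum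
`Σ_{k ≤ 16} p(k) (2/3)^k ≥ 44068724/43046721 > 1` propagates the base `c(2j) ≥ 1`, `j ≤ 7`.
[cite: MadrasSlade1993, §4.2 (Kesten's renewal bound), here along the diagonal with a finite certificate] -/
theorem pow_le_card_diagClass_mul_pow (j : ℕ) :
    (4 / 9 : ℝ) ^ 7 ≤ (diagClass (2 * j)).card * (4 / 9 : ℝ) ^ j := by
  induction j using Nat.strong_induction_on with
  | _ j ih =>
    set x : ℝ := 4 / 9 with hx
    have hx0 : 0 < x := by norm_num [hx]
    rcases lt_or_ge j 8 with hj | hj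
    · have h1 : (1 : ℝ) ≤ (diagClass (2 * j)).card := by exact_mod_cast one_le_card_diagClass_two_mul j
      have h2 : x ^ 7 ≤ x ^ j := pow_le_pow_of_le_one hx0.le (by norm_num [hx]) (by omega)
      calc x ^ 7 ≤ x ^ j := h2
        _ = 1 * x ^ j := (one_mul _).symm
        _ ≤ (diagClass (2 * j)).card * x ^ j := mul_le_mul_of_nonneg_right h1 (pow_pos hx0 j).le
    · have hr := renewal_sixteen j hj
      have p2 : (1 : ℝ) ≤ (diagIrr 2).card := by exact_mod_cast card_diagIrr_2
      have p4 : (1 : ℝ) ≤ (diagIrr 4).card := by exact_mod_cast card_diagIrr_4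
      have p6 : (2 : ℝ) ≤ (diagIrr 6).card := by exact_mod_cast card_diagIrr_6
      have p8 : (2 : ℝ) ≤ (diagIrr 8).card := by exact_mod_cast card_diagIrr_8
      have p10 : (3 : ℝ) ≤ (diagIrr 10).card := by exact_mod_cast card_diagIrr_10
      have p12 : (4 : ℝ) ≤ (diagIrr 12).card := by exact_mod_cast card_diagIrr_12
      have p14 : (7 : ℝ) ≤ (diagIrr 14).card := by exact_mod_cast card_diagIrr_14
      have p16 : (14 : ℝ) ≤ (diagIrr 16).card := by exact_mod_cast card_diagIrr_16
      have t1 := term_bound (i := 1) hx0 p2 (ih (j - 1) (by omega)) zero_le_one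
      have t2 := term_bound (i := 2) hx0 p4 (ih (j - 2) (by omega)) zero_le_one
      have t3 := term_bound (i := 3) hx0 p6 (ih (j - 3) (by omega)) zero_le_two
      have t4 := term_bound (i := 4) hx0 p8 (ih (j - 4) (by omega)) zero_le_two
      have t5 := term_bound (i := 5) hx0 p10 (ih (j - 5) (by omega)) zero_le_three
      have t6 := term_bound (i := 6) hx0 p12 (ih (j - 6) (by omega)) zero_le_four
      have t7 := term_bound (i := 7) hx0 p14 (ih (j - 7) (by omega)) (by norm_num)
      have t8 := term_bound (i := 8) hx0 p16 (ih (j - 8) (by omega)) (by norm_num)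
      have e1 : x ^ 1 * x ^ (j - 1) = x ^ j := by rw [← pow_add]; congr 1; omega
      have e2 : x ^ 2 * x ^ (j - 2) = x ^ j := by rw [← pow_add]; congr 1; omega
      have e3 : x ^ 3 * x ^ (j - 3) = x ^ j := by rw [← pow_add]; congr 1; omega
      have e4 : x ^ 4 * x ^ (j - 4) = x ^ j := by rw [← pow_add]; congr 1; omega
      have e5 : x ^ 5 * x ^ (j - 5) = x ^ j := by rw [← pow_add]; congr 1; omega
      have e6 : x ^ 6 * x ^ (j - 6) = x ^ j := by rw [← pow_add]; congr 1; omega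
      have e7 : x ^ 7 * x ^ (j - 7) = x ^ j := by rw [← pow_add]; congr 1; omega
      have e8 : x ^ 8 * x ^ (j - 8) = x ^ j := by rw [← pow_add]; congr 1; omega
      rw [e1] at t1; rw [e2] at t2; rw [e3] at t3; rw [e4] at t4
      rw [e5] at t5; rw [e6] at t6; rw [e7] at t7; rw [e8] at t8
      have hsum := mul_le_mul_of_nonneg_right hr (pow_pos hx0 j).le
      have hS : (1 : ℝ) ≤ 1 * x ^ 1 + 1 * x ^ 2 + 2 * x ^ 3 + 2 * x ^ 4 + 3 * x ^ 5 + 4 * x ^ 6 + 7 * x ^ 7 +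
          14 * x ^ 8 := by norm_num [hx]
      have hdist : (((diagIrr 2).card : ℝ) * (diagClass (2 * (j - 1))).card +
          (((diagIrr 4).card : ℝ) * (diagClass (2 * (j - 2))).card +
          (((diagIrr 6).card : ℝ) * (diagClass (2 * (j - 3))).card +
          (((diagIrr 8).card : ℝ) * (diagClass (2 * (j - 4))).card +
          (((diagIrr 10).card : ℝ) * (diagClass (2 * (j - 5))).card +
          (((diagIrr 12).card : ℝ) * (diagClass (2 * (j - 6))).card +
          (((diagIrr 14).card : ℝ) * (diagClass (2 * (j - 7))).card +
          ((diagIrr 16).card : ℝ) * (diagClass (2 * (j - 8))).card))))))) * x ^ j =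
          ((diagIrr 2).card : ℝ) * (diagClass (2 * (j - 1))).card * x ^ j +
          ((diagIrr 4).card : ℝ) * (diagClass (2 * (j - 2))).card * x ^ j +
          ((diagIrr 6).card : ℝ) * (diagClass (2 * (j - 3))).card * x ^ j +
          ((diagIrr 8).card : ℝ) * (diagClass (2 * (j - 4))).card * x ^ j +
          ((diagIrr 10).card : ℝ) * (diagClass (2 * (j - 5))).card * x ^ j +
          ((diagIrr 12).card : ℝ) * (diagClass (2 * (j - 6))).card * x ^ j +
          ((diagIrr 14).card : ℝ) * (diagClass (2 * (j - 7))).card * x ^ j +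
          ((diagIrr 16).card : ℝ) * (diagClass (2 * (j - 8))).card * x ^ j := by ring
      rw [hdist] at hsum
      have hL : x ^ 7 * (1 * x ^ 1 + 1 * x ^ 2 + 2 * x ^ 3 + 2 * x ^ 4 + 3 * x ^ 5 + 4 * x ^ 6 + 7 * x ^ 7 +
          14 * x ^ 8) = x ^ 7 * (1 * x ^ 1) + x ^ 7 * (1 * x ^ 2) + x ^ 7 * (2 * x ^ 3) + x ^ 7 * (2 * x ^ 4) +
          x ^ 7 * (3 * x ^ 5) + x ^ 7 * (4 * x ^ 6) + x ^ 7 * (7 * x ^ 7) + x ^ 7 * (14 * x ^ 8) := by ring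
      have main : x ^ 7 * (1 * x ^ 1 + 1 * x ^ 2 + 2 * x ^ 3 + 2 * x ^ 4 + 3 * x ^ 5 + 4 * x ^ 6 + 7 * x ^ 7 +
          14 * x ^ 8) ≤ (diagClass (2 * j)).card * x ^ j := by
        rw [hL]
        linarith [t1, t2, t3, t4, t5, t6, t7, t8, hsum]
      calc x ^ 7 = x ^ 7 * 1 := (mul_one _).symm
        _ ≤ x ^ 7 * (1 * x ^ 1 + 1 * x ^ 2 + 2 * x ^ 3 + 2 * x ^ 4 + 3 * x ^ 5 + 4 * x ^ 6 + 7 * x ^ 7 +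
            14 * x ^ 8) := mul_le_mul_of_nonneg_left hS (pow_pos hx0 7).le
        _ ≤ (diagClass (2 * j)).card * x ^ j := main

namespace Zd

/-- **`a(N) ≥ (3/2)^N` for every `N`**: `a(N)^{2j} ≥ a(2jN) ≥ c(2jN) ≥ (4/9)^7 (9/4)^{jN}` for all `j`, and
`j → ∞`. [cite: MadrasSlade1993, §1.2 (submultiplicativity) and §4.2 (renewal bound)] -/
theorem pow_three_halves_le_allTurnCount (N : ℕ) : (3 / 2 : ℝ) ^ N ≤ allTurnCount N := by
  set A : ℝ := (allTurnCount N : ℝ) with hA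
  set B : ℝ := (3 / 2 : ℝ) ^ N with hB
  have hA1 : (1 : ℝ) ≤ A := by rw [hA]; exact_mod_cast one_le_allTurnCount N
  have hB0 : 0 < B := by positivity
  -- `A^{2j} ≥ (4/9)^7 B^{2j}` for every `j`
  have key : ∀ j : ℕ, (4 / 9 : ℝ) ^ 7 * B ^ (2 * j) ≤ A ^ (2 * j) := by
    intro j
    have h1 : (allTurnCount (2 * j * N) : ℝ) ≤ A ^ (2 * j) := by
      rw [hA]; exact_mod_cast allTurnCount_mul_le_pow (2 * j) N
    have h2 : ((diagClass (2 * (j * N))).card : ℝ) ≤ allTurnCount (2 * j * N) := by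
      rw [allTurnCount_eq_card_allTurnWords, mul_assoc]
      exact_mod_cast Finset.card_le_card (diagClass_subset_allTurnWords _)
    have h3 := pow_le_card_diagClass_mul_pow (j * N)
    have h4 : B ^ (2 * j) * (4 / 9 : ℝ) ^ (j * N) = 1 := by
      rw [hB, ← pow_mul, show N * (2 * j) = 2 * (j * N) by ring, pow_mul, ← mul_pow]
      norm_num
    have h5 : (4 / 9 : ℝ) ^ 7 * B ^ (2 * j) ≤ (diagClass (2 * (j * N))).card := by
      calc (4 / 9 : ℝ) ^ 7 * B ^ (2 * j)
          ≤ ((diagClass (2 * (j * N))).card * (4 / 9 : ℝ) ^ (j * N)) * B ^ (2 * j) :=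
            mul_le_mul_of_nonneg_right h3 (by positivity)
        _ = (diagClass (2 * (j * N))).card * (B ^ (2 * j) * (4 / 9 : ℝ) ^ (j * N)) := by ring
        _ = (diagClass (2 * (j * N))).card := by rw [h4, mul_one]
    exact h5.trans (h2.trans h1)
  by_contra hlt
  rw [not_le] at hlt
  -- `(A/B)^{2j} → 0`, contradicting `key`
  have hr0 : 0 ≤ A / B := by positivity
  have hr1 : A / B < 1 := (div_lt_one hB0).2 hlt
  have ht : Tendsto (fun j : ℕ => (A / B) ^ (2 * j)) atTop (𝓝 0) :=
    (tendsto_pow_atTop_nhds_zero_of_lt_one hr0 hr1).comp (tendsto_id.const_mul_atTop' (by norm_num))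
  have hev := ht.eventually (gt_mem_nhds (show (0 : ℝ) < (4 / 9 : ℝ) ^ 7 by positivity))
  obtain ⟨j, hj⟩ := hev.exists
  have hk := key j
  rw [div_pow] at hj
  rw [div_lt_iff₀ (by positivity)] at hj
  linarith

/-- **`MuATLower (3/2)`: `log (3/2) ≤ log μ_AT`** — a certified lower bound `μ_AT ≥ 3/2` for the all-turn
(L-lattice) connective constant, with standard axioms (item «MuATLower (3/2)» of the lane «pcv-sawmu»; a-idea-2's
`V7E.MuATLower (3/2)` body with the tree's `logMuAT`). Numerically `μ_L = 1.5657(15)` [cite: JensenGuttmann1998, Table 1];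
the L-lattice identification [cite: Kennedy2018ManhattanSLE6, §1 (p. 4)]; method [cite: MadrasSlade1993, §1.2 and §4.2]
with an explicit finite certificate. -/
theorem muATLower_three_halves : Real.log (3 / 2) ≤ logMuAT := by
  refine le_ciInf fun N => ?_
  have h := pow_three_halves_le_allTurnCount (N + 1)
  have hlog : ((N : ℝ) + 1) * Real.log (3 / 2) ≤ Real.log (allTurnCount (N + 1)) := by
    rw [← Nat.cast_succ, ← Real.log_pow]
    exact Real.log_le_log (by positivity) h
  rw [le_div_iff₀ (by positivity)]
  linarith

end Zd

end Literature.Probability.RandomPlanarGeometry.SAW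

end
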